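import Literature.NumberTheory.LFunctions.ConreyIwaniec2002Prop81MeanSquares
import Literature.NumberTheory.LFunctions.ConreyIwaniec2002Prop81LargeCloseOf
import HarnessLib

/-!
# Conrey–Iwaniec (2002), Proposition 8.1 (`_large_close`) from Proposition 6.4, the residual bound and the divisor moment

B. Conrey, H. Iwaniec, *Spacing of zeros of Hecke L-functions and the class number problem*,
Acta Arith. 103 (2002), §8 (8.5)–(8.10) [held text `paper:arxiv-math_0111012`, p0018].

Glue of the line `prop81-afe-plancherel`: the two main mean squares of §8 are the tree's
`ConreyIwaniec2002.main_meanSquares` (from Proposition 6.4 = `h64` and the smoothed second moment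
of the divisor function `hdiv`); adding the residual mean square `hres` (the corrected residual of
Proposition 7.1 is `≪ q²e^{−t²}`, so `Σ_s|r(s)|² ≪ T`) gives the three mean squares `hS6` consumed
by `prop81_large_close_of_meanSquares`. Hence
`conreyIwaniec2002_proposition81_large_close` from `h64`, `hres`, `hdiv`
(`prop81_large_close_of_prop64_residual_divisor`); `hres` and `hdiv` are the registered stubs
S6a / S6b of the line, being landed separately. Everything PROVED; no definition.

«The programme SEARCHES and TYPES; no claim about Landau–Siegel zeros until a kernel theorem says so.»

## References
* [ConreyIwaniec2002] B. Conrey, H. Iwaniec, Acta Arith. 103 (2002) 259–312, arXiv:math/0111012: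
  §8 (8.5)–(8.10); Proposition 6.4; Proposition 7.1 (7.12).
-/

noncomputable section

open scoped NumberField
open Complex

namespace Literature.NumberTheory.LFunctions

namespace ConreyIwaniec2002

open NumberField

/-- **The three mean squares of §8 from Proposition 6.4, the residual bound and the divisor
moment** (constant `max C₁ C₂`). [cite: ConreyIwaniec2002, §8 (8.5)–(8.10)] -/
theorem meanSquares_of_residual_divisor (h64 : conreyIwaniec2002_proposition64)
    (hres : ∃ C : ℝ, 0 < C ∧
        ∀ (q : ℕ) [NeZero q], 4 < q →
          ∀ (K : Type) [Field K] [NumberField K],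
            Module.finrank ℚ K = 2 → NumberField.discr K = -(q : ℤ) →
              ∀ (ψ : ClassGroup (𝓞 K) →* ℂˣ) (T : ℝ) (S : Finset ℝ) (t' : ℝ → ℝ),
                (q : ℝ) ^ (66 : ℕ) ≤ T → IsDyadicPointSet S T → (∀ t ∈ S, t' t ≠ t ∧ |t' t - t| ≤ 1) →
                  ∑ t ∈ S, ‖(afeR K ψ q (1 / 2 + t * I) - afeR K ψ q (1 / 2 + t' t * I)) /
                      ((t : ℂ) * I - t' t * I)‖ ^ 2 ≤ C * T)
    (hdiv : ∃ C : ℝ, 0 < C ∧ ∀ Y : ℝ, 2 ≤ Y →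
          Summable (fun n : ℕ => ((1 + (n : ℝ) / Y) ^ 8)⁻¹ * (n.divisors.card : ℝ) ^ 2) ∧
          ∑' n : ℕ, ((1 + (n : ℝ) / Y) ^ 8)⁻¹ * (n.divisors.card : ℝ) ^ 2 ≤
            C * Y * (1 + Real.log Y) ^ 4) :
    ∃ C : ℝ, 0 < C ∧
      ∀ (q : ℕ) [NeZero q], 4 < q → Odd q → ∀ χ : DirichletCharacter ℂ q,
        χ.IsPrimitive → χ.IsQuadratic → χ.Odd →
          ∀ (K : Type) [Field K] [NumberField K],
            Module.finrank ℚ K = 2 → NumberField.discr K = -(q : ℤ) →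
              ∀ (ψ : ClassGroup (𝓞 K) →* ℂˣ) (T : ℝ) (S : Finset ℝ) (t' : ℝ → ℝ),
                (q : ℝ) ^ (66 : ℕ) ≤ T → Real.exp (Real.log q ^ (2 : ℕ)) ≤ T → IsDyadicPointSet S T →
                  (∀ t ∈ S, t' t ≠ t ∧ |t' t - t| ≤ 1) →
                  (∑ t ∈ S, ‖(afeA K ψ q (1 / 2 + t * I) - afeA K ψ q (1 / 2 + t' t * I)) /
                      ((t : ℂ) * I - t' t * I)‖ ^ 2 ≤
                    C * (T * Real.log q ^ (7 : ℕ) + T * calL χ T * Real.log T ^ (4 : ℕ))) ∧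
                  (Real.log T ^ (2 : ℕ) *
                      ∑ t ∈ S, ‖afeA K ψ q (1 / 2 + t * I) - shortLSum K ψ q (1 / 2 + t * I)‖ ^ 2 ≤
                    C * (T * Real.log q ^ (7 : ℕ) + T * calL χ T * Real.log T ^ (4 : ℕ))) ∧
                  (∑ t ∈ S, ‖(afeR K ψ q (1 / 2 + t * I) - afeR K ψ q (1 / 2 + t' t * I)) /
                      ((t : ℂ) * I - t' t * I)‖ ^ 2 ≤ C * T) := by
  obtain ⟨C₁, hC₁, h₁⟩ := main_meanSquares h64 hdiv
  obtain ⟨C₂, hC₂, h₂⟩ := hres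
  refine ⟨max C₁ C₂, lt_max_of_lt_left hC₁, ?_⟩
  intro q _ hq hodd χ hprim hquad hχodd K _ _ h2 hdisc ψ T S t' hT hexpT hS ht'
  obtain ⟨hA, hB⟩ := h₁ q hq hodd χ hprim hquad hχodd K h2 hdisc ψ T S t' hT hexpT hS ht'
  have hR := h₂ q hq K h2 hdisc ψ T S t' hT hS ht'
  have hT0 : 0 ≤ T := le_trans (by positivity) hT
  have hq1 : (1 : ℝ) ≤ q := by exact_mod_cast (by omega : 1 ≤ q)
  have hX : 0 ≤ T * Real.log q ^ (7 : ℕ) + T * calL χ T * Real.log T ^ (4 : ℕ) := by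
    have h1 : 0 ≤ Real.log q := Real.log_nonneg hq1
    have h2 : 0 ≤ Real.log T := Real.log_nonneg (le_trans (le_trans hq1 (by
      have h := pow_le_pow_right₀ hq1 (show 1 ≤ 66 by norm_num)
      rwa [pow_one] at h)) hT)
    have h3 : 0 ≤ calL χ T := calL_nonneg χ (le_trans (le_trans hq1 (by
      have h := pow_le_pow_right₀ hq1 (show 1 ≤ 66 by norm_num)
      rwa [pow_one] at h)) hT)
    positivity
  refine ⟨hA.trans ?_, hB.trans ?_, hR.trans ?_⟩
  · exact mul_le_mul_of_nonneg_right (le_max_left _ _) hX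
  · exact mul_le_mul_of_nonneg_right (le_max_left _ _) hX
  · exact mul_le_mul_of_nonneg_right (le_max_right _ _) hT0

/-- **CI Proposition 8.1 in the `_large_close` form from Proposition 6.4 (`h64`), the residual
mean square (`hres`, stub S6a) and the divisor second moment (`hdiv`, stub S6b).**
[cite: ConreyIwaniec2002, Proposition 8.1 (8.10)] -/
theorem prop81_large_close_of_prop64_residual_divisor (h64 : conreyIwaniec2002_proposition64)
    (hres : ∃ C : ℝ, 0 < C ∧
        ∀ (q : ℕ) [NeZero q], 4 < q →
          ∀ (K : Type) [Field K] [NumberField K],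
            Module.finrank ℚ K = 2 → NumberField.discr K = -(q : ℤ) →
              ∀ (ψ : ClassGroup (𝓞 K) →* ℂˣ) (T : ℝ) (S : Finset ℝ) (t' : ℝ → ℝ),
                (q : ℝ) ^ (66 : ℕ) ≤ T → IsDyadicPointSet S T → (∀ t ∈ S, t' t ≠ t ∧ |t' t - t| ≤ 1) →
                  ∑ t ∈ S, ‖(afeR K ψ q (1 / 2 + t * I) - afeR K ψ q (1 / 2 + t' t * I)) /
                      ((t : ℂ) * I - t' t * I)‖ ^ 2 ≤ C * T)
    (hdiv : ∃ C : ℝ, 0 < C ∧ ∀ Y : ℝ, 2 ≤ Y →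
          Summable (fun n : ℕ => ((1 + (n : ℝ) / Y) ^ 8)⁻¹ * (n.divisors.card : ℝ) ^ 2) ∧
          ∑' n : ℕ, ((1 + (n : ℝ) / Y) ^ 8)⁻¹ * (n.divisors.card : ℝ) ^ 2 ≤
            C * Y * (1 + Real.log Y) ^ 4) :
    conreyIwaniec2002_proposition81_large_close :=
  prop81_large_close_of_meanSquares (meanSquares_of_residual_divisor h64 hres hdiv)

end ConreyIwaniec2002

end Literature.NumberTheory.LFunctions
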